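import Literature.Computability.Complexity.PPolyReductions
import Literature.Computability.Complexity.CircuitEval
import Literature.Computability.Complexity.ListFoldBricks
import Literature.Computability.Complexity.StringCopy
import Literature.Computability.Complexity.StackLists
import Literature.Computability.Complexity.BrickAlgebra
import HarnessLib

/-!
# Seed lists keep `P/poly`: the derandomised decider of a one-sided randomized reduction

Stub `stub_seedListPPoly` of the line `Sketch` for the crux `IqThreeNotPPoly`
(`SQUAREFREES ∉ P/poly → IQ3 ∉ P/poly`). Given a polynomial-time map `f ∈ FP`, a language
`L₂ ∈ P/poly`, and for every input length `n` a list `R n` of polynomially many, polynomially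
short *seeds*, the language `{x | ∃ r ∈ R |x|, f ⟨x, r⟩ ∈ L₂}` is in `P/poly` — the closure step
of Adleman's argument (`BPP ⊆ P/poly`, Arora–Barak 2009, Thm. 7.14) once a hitting set of seeds
has been fixed per length.

The proof is the advice-table argument of `preimage_mem_polyAdvice` (`PPolyReductions.lean`,
Arora–Barak 2009, Def. 6.16, Thm. 6.18): through `P/poly = P/poly-advice`
(`PPoly_eq_polyAdvice_P_holds`), `L₂ = {y | ⟨y, a |y|⟩ ∈ L'}` with `L' ∈ P`; the advice for the
target at length `n` is `⟨encList (R n), ⟨a 0, ⟨a 1, … ⟨a (s n), ε⟩…⟩⟩⟩` with `s n` a polynomial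
bound on `|f ⟨x, r⟩|` over `|x| = n`, `r ∈ R n`, and the witness language tests, with the
`FP` disjunction brick `Brick.anyFn` over the items of the coded seed list (`ListFoldBricks.lean`),
whether some seed `r` has `⟨y, a |y|⟩ ∈ L'` for `y = f ⟨x, r⟩`, reading `a |y|` off the table
(`exists_lookup_mem_FP`).

## References

* L. Adleman, *Two theorems on random polynomial time*, Proc. 19th FOCS (1978), 75–83.
* S. Arora, B. Barak, *Computational Complexity: A Modern Approach*, CUP 2009, Def. 6.16,
  Thm. 6.18, Thm. 7.14.
-/

set_option linter.dupNamespace false -- D-0017: single-problem summit ⇒ `QuantumAdvantage.QuantumAdvantage` by design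

namespace Summit.QuantumAdvantage.QuantumAdvantage.Theorems.IqThreeNotPPoly

open _root_.Computability Literature.Computability.Complexity
open Polynomial Brick

/-- **Seed lists keep `P/poly`.** For `f ∈ FP`, `L₂ ∈ P/poly` and seed lists `R n` with
`|R n| ≤ p n` and `|r| ≤ p n` for `r ∈ R n`, the language `{x | ∃ r ∈ R |x|, f ⟨x, r⟩ ∈ L₂}` is in
`P/poly` (advice: the coded seed list together with the table of the advice strings of `L₂` up to
the output length of `f`; witness: an `FP` disjunction over the seeds). The closure half of
Adleman's `BPP ⊆ P/poly` argument (Arora–Barak 2009, Def. 6.16, Thm. 6.18, Thm. 7.14). -/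
theorem stub_seedListPPoly :
    ∀ (L₂ : Language Bool) (f : List Bool → List Bool), f ∈ FP → L₂ ∈ PPoly →
      ∀ (R : ℕ → List (List Bool)) (p : Polynomial ℕ),
        (∀ n, (R n).length ≤ p.eval n) → (∀ n, ∀ r ∈ R n, r.length ≤ p.eval n) →
          ({x : List Bool | ∃ r ∈ R x.length, f (boolPair x r) ∈ L₂} : Language Bool) ∈ PPoly := by
  intro L₂ f hf hL₂ R p hRlen hRitem
  have hPP : PPoly = polyAdvice Classes.P := PPoly_eq_polyAdvice_P_holds
  rw [hPP] at hL₂ ⊢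
  obtain ⟨L', hL', a, p₂, hp₂, hLa⟩ := hL₂
  obtain ⟨look, hlook, hspec⟩ := exists_lookup_mem_FP
  -- polynomial output length of `f`
  obtain ⟨s, hs⟩ : ∃ s : Polynomial ℕ, ∀ x, (f x).length ≤ s.eval x.length := by
    obtain ⟨q, M, hM⟩ := hf
    refine ⟨X + C (TM2Comp.machinePushBound M.tm) * q, fun x => ?_⟩
    have h := (hM x).length_le
    simpa using h
  -- output length of `f` on seeded inputs `⟨x, r⟩`, `r ∈ R |x|`
  obtain ⟨S, hS⟩ : ∃ S : Polynomial ℕ, ∀ (x r : List Bool), r ∈ R x.length →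
      (f (boolPair x r)).length ≤ S.eval x.length := by
    refine ⟨s.comp (2 * X + 2 + p), fun x r hr => (hs _).trans ?_⟩
    have hr' := hRitem _ r hr
    simp only [eval_comp, eval_add, eval_mul, eval_X, eval_ofNat, length_boolPair]
    exact TM2Iter.eval_mono s (by omega)
  -- the coded seed list is the table code of `PPolyReductions.lean`
  have hfold : ∀ l : List (List Bool), encList l = l.foldr boolPair [] := by
    intro l
    induction l with
    | nil => rfl
    | cons b l ih => rw [encList_cons, List.foldr_cons, ih]
  -- the advice table of `L₂`'s advice strings, up to index `S n`
  obtain ⟨tab, htab_len, htab_get, htab_B⟩ : ∃ tab : ℕ → List (List Bool),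
      (∀ n, (tab n).length = S.eval n + 1) ∧
      (∀ n m (h : m < (tab n).length), (tab n)[m] = a m) ∧
      (∀ n, ∀ t ∈ tab n, t.length ≤ p₂.eval (S.eval n)) := by
    refine ⟨fun n => (List.range (S.eval n + 1)).map a, fun n => by simp, fun n m h => by simp,
      fun n t ht => ?_⟩
    simp only [List.mem_map, List.mem_range] at ht
    obtain ⟨m, hm, rfl⟩ := ht
    exact (hp₂ m).trans (TM2Iter.eval_mono p₂ (by omega))
  -- the item test `c ⟨⟨x, Tab⟩, r⟩ = [⟨y, look ⟨y, Tab⟩⟩ ∈ L']`, `y = f ⟨x, r⟩`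
  have hind : (fun z => encodeBool (L'.boolIndicator z)) ∈ FP := indicatorFn_mem_FP hL'
  have hyF : f ∘ fanoutFn (fstF ∘ fstF) sndF ∈ FP :=
    comp_mem_FP hf (fanoutFn_mem_FP (comp_mem_FP fstF_mem_FP fstF_mem_FP) sndF_mem_FP)
  set c : List Bool → List Bool := (fun z => encodeBool (L'.boolIndicator z)) ∘
    fanoutFn (f ∘ fanoutFn (fstF ∘ fstF) sndF)
      (look ∘ fanoutFn (f ∘ fanoutFn (fstF ∘ fstF) sndF) (sndF ∘ fstF)) with hc_def
  have hc : c ∈ FP :=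
    comp_mem_FP hind (fanoutFn_mem_FP hyF
      (comp_mem_FP hlook (fanoutFn_mem_FP hyF (comp_mem_FP sndF_mem_FP fstF_mem_FP))))
  have h1c : OneBit c := fun z => ⟨_, rfl⟩
  have hcval : ∀ (x r : List Bool), r ∈ R x.length →
      (c (boolPair (boolPair x ((tab x.length).foldr boolPair [])) r) = [true] ↔
        f (boolPair x r) ∈ L₂) := by
    intro x r hr
    have hlt : (f (boolPair x r)).length < (tab x.length).length := by
      rw [htab_len]
      exact Nat.lt_succ_of_le (hS x r hr)
    simp only [hc_def, Function.comp_apply, fanoutFn_apply, fstF_boolPair, sndF_boolPair]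
    rw [hspec _ _ hlt, htab_get, hLa (f (boolPair x r))]
    refine Iff.trans ?_ (Set.mem_iff_boolIndicator _ _).symm
    cases Set.boolIndicator L' (boolPair (f (boolPair x r)) (a (f (boolPair x r)).length)) <;> decide
  -- the witness function: rearrange `⟨x, ⟨Rcode, Tab⟩⟩ ↦ ⟨⟨x, Tab⟩, Rcode⟩`, then `anyFn c`
  set G : List Bool → List Bool :=
    anyFn c ∘ fanoutFn (fanoutFn fstF (sndF ∘ sndF)) (fstF ∘ sndF) with hG_def
  have hG : G ∈ FP :=
    comp_mem_FP (anyFn_mem_FP hc h1c) (fanoutFn_mem_FP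
      (fanoutFn_mem_FP fstF_mem_FP (comp_mem_FP sndF_mem_FP sndF_mem_FP))
      (comp_mem_FP fstF_mem_FP sndF_mem_FP))
  have h1G : OneBit G := (oneBit_anyFn h1c).comp _
  have hL'' : ({w | G w = [true]} : Language Bool) ∈ Classes.P :=
    mem_P_of_mem_FP hG _ fun w => ⟨fun h => h, fun h => by
      obtain ⟨b, hb⟩ := h1G w
      cases b
      · exact hb
      · exact absurd hb h⟩
  refine ⟨{w | G w = [true]}, hL'',
    fun n => boolPair (encList (R n)) ((tab n).foldr boolPair []),
    2 * (p * (2 * p + 2)) + 2 + (S + 1) * (2 * p₂.comp S + 2), fun n => ?_, fun x => ?_⟩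
  · -- advice length
    have hT : ((tab n).foldr boolPair []).length ≤ (S.eval n + 1) * (2 * p₂.eval (S.eval n) + 2) := by
      refine (length_foldr_boolPair_le _ (htab_B n)).trans (le_of_eq ?_)
      rw [htab_len]
    have hE : (encList (R n)).length ≤ p.eval n * (2 * p.eval n + 2) := by
      rw [hfold]
      exact (length_foldr_boolPair_le _ (hRitem n)).trans (Nat.mul_le_mul_right _ (hRlen n))
    simp only [length_boolPair, eval_add, eval_mul, eval_ofNat, eval_one, eval_comp]
    omega
  · -- membership
    change (∃ r ∈ R x.length, f (boolPair x r) ∈ L₂) ↔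
      G (boolPair x (boolPair (encList (R x.length)) ((tab x.length).foldr boolPair []))) = [true]
    simp only [hG_def, Function.comp_apply, fanoutFn_apply, fstF_boolPair, sndF_boolPair]
    rw [anyFn_boolPair h1c, decNil_encList, List.cons.injEq, decide_eq_true_iff]
    simp only [and_true]
    exact exists_congr fun r => and_congr_right fun hr => (hcval x r hr).symm

end Summit.QuantumAdvantage.QuantumAdvantage.Theorems.IqThreeNotPPoly
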